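import Summits.QuantumFields.GaugeBoot.Certificates.SparseReducedSweepU
import HarnessLib

/-!
# Sparse certificate replay, part 5: raw-recursor sweep and WINDOWED RESIDUAL SUMS (no trace / residual tables)

HONEST FRAMING (cell `pub-gaugeboot`): certified bounds on lattice expectations at stated coupling,
gauge group, dimension and torus size; NOT a mass gap, NOT a continuum limit, NOT a string tension;
NOT Yang–Mills-summit-bearing (barriers `FixedCouplingUltralocality`, `PerturbativeInvisibility`).

Generic support for the cell-side emitter `gb_lean_emit_reduced` ≥ 0.9 (large reduced families: kz-L2-rp-4D,
10 878 variables, 70 blocks ≤ 48, ≈ 9·10⁵ entry positions).  Two changes w.r.t. parts 4c/4d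
(`SparseReducedSweep(U)`), both `[folklore]`:

* the lockstep entry sweep is re-implemented with RAW recursors (`Nat.rec` / `List.rec` / `casesOn`, explicit
  `Int.*` / `Nat.*` operations) — `Trie.addR`, `accTermsR`, `accRowR`, `accIR`, `accKR`, `sweepR` — and proved
  EQUAL to the part-4d functions (`sweepR_eq`, under the cheap family check `rowLenCheck`), so every semantic lemma
  transfers; on the farm the equation-compiler (`brecOn`) versions cost ≈ 1.6× more kernel time per stored term and
  admit ≈ 3× fewer terms per `decide` under the memory cap (measured on the tree family `N2c2D4`, 2026-08-22);
* the certificate no longer carries a trace table `T` or a residual table `R`: a variable WINDOW `lo ≤ v < hi`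
  is swept into the trie and the window's contribution to the Jansson–Chaykin–Keil bound,
  `s = Σ_{v in window} g_v`, `g_0 = −N_0`, `g_v = |N_v|` (`v ≥ 1`), with the INTEGER residual numerator
  `N_v = (c_v · D − n_v) · 4^K − t_v · D` (objective coefficient `c_v ∈ ℤ`, aggregated equality row `a_v = n_v / D`,
  trace value `Σ_k tr (Z_k F⁽ᵏ⁾_v) = t_v / 4^K`), is checked against ONE emitted integer `s` per window
  (`winCheck` / `WinOK`, concatenation `WinOK.append`, in the sequel `SparseReducedWindowBound.lean`); `objective_bound_win` there assembles
  `lower ≤ (rhs_N · 4^K − S) / (D · 4^K) ≤ c · y` (`finalCheckW`) from `JanssonChaykinKeil.lmiForm_bound` for the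
  AGGREGATED-EQUALITY form (one equality `Σ_v (n_v / D) y_v = rhs_N / D`).
Nothing here is specific to lattice gauge theory.
-/

namespace Summit.QuantumFields.GaugeBoot.Certificates.Sparse

open Matrix Finset Literature.Computation.Certificates

noncomputable section

/-- `Nat.beq a b = false` from `a ≠ b`. [folklore] -/
private theorem nat_beq_false {a b : ℕ} (h : a ≠ b) : Nat.beq a b = false := by
  cases hq : Nat.beq a b
  · rfl
  · exact absurd (Nat.eq_of_beq_eq_true hq) h

/-! ## Raw-recursor twins of the part-4d sweep -/

namespace Trie

/-- Left subtree via `casesOn`. [folklore] -/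
def leftR (t : Trie) : Trie := @Trie.casesOn (fun _ => Trie) t nil (fun _ => nil) (fun l _ => l)

/-- Right subtree via `casesOn`. [folklore] -/
def rightR (t : Trie) : Trie := @Trie.casesOn (fun _ => Trie) t nil (fun _ => nil) (fun _ r => r)

/-- `leftR = left`. [folklore] -/
@[simp] theorem leftR_eq (t : Trie) : t.leftR = t.left := by cases t <;> rfl

/-- `rightR = right`. [folklore] -/
@[simp] theorem rightR_eq (t : Trie) : t.rightR = t.right := by cases t <;> rfl

/-- `add` via the raw recursor on the depth (explicit `Nat.mod` / `Nat.div` / `Nat.beq`, `Int.add`). [folklore] -/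
def addR (d : ℕ) : Trie → ℕ → ℤ → Trie :=
  @Nat.rec (fun _ => Trie → ℕ → ℤ → Trie)
    (fun t _ c => @Trie.casesOn (fun _ => Trie) t (leaf c) (fun z => leaf (Int.add z c)) (fun _ _ => leaf c))
    (fun _ ih t w c => bif Nat.beq (Nat.mod w 2) 0 then node (ih (leftR t) (Nat.div w 2) c) (rightR t)
      else node (leftR t) (ih (rightR t) (Nat.div w 2) c)) d

/-- Unfolding `addR` one level. [folklore] -/
theorem addR_succ (d : ℕ) (t : Trie) (w : ℕ) (c : ℤ) : addR (d + 1) t w c =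
    (bif Nat.beq (Nat.mod w 2) 0 then node (addR d (leftR t) (Nat.div w 2) c) (rightR t)
      else node (leftR t) (addR d (rightR t) (Nat.div w 2) c)) := rfl

/-- `addR = add`. [folklore] -/
theorem addR_eq : ∀ (d : ℕ) (t : Trie) (w : ℕ) (c : ℤ), addR d t w c = add d t w c
  | 0, nil, _, _ => rfl
  | 0, leaf _, _, _ => rfl
  | 0, node _ _, _, _ => rfl
  | d + 1, t, w, c => by
    rw [addR_succ, leftR_eq, rightR_eq, show Nat.div w 2 = w / 2 from rfl, show Nat.mod w 2 = w % 2 from rfl,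
      addR_eq d t.left, addR_eq d t.right, add]
    by_cases h : w % 2 = 0
    · rw [if_pos h, h]; rfl
    · rw [if_neg h, nat_beq_false h]; rfl

/-- `get` via the raw recursor on the depth. [folklore] -/
def getR (d : ℕ) : Trie → ℕ → ℤ :=
  @Nat.rec (fun _ => Trie → ℕ → ℤ)
    (fun t _ => @Trie.casesOn (fun _ => ℤ) t 0 (fun z => z) (fun _ _ => 0))
    (fun _ ih t w => @Trie.casesOn (fun _ => ℤ) t 0 (fun _ => 0)
      (fun l r => bif Nat.beq (Nat.mod w 2) 0 then ih l (Nat.div w 2) else ih r (Nat.div w 2))) d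

/-- Unfolding `getR` one level on a node. [folklore] -/
theorem getR_succ_node (d : ℕ) (l r : Trie) (w : ℕ) : getR (d + 1) (node l r) w =
    (bif Nat.beq (Nat.mod w 2) 0 then getR d l (Nat.div w 2) else getR d r (Nat.div w 2)) := rfl

/-- `getR = get`. [folklore] -/
theorem getR_eq : ∀ (d : ℕ) (t : Trie) (w : ℕ), getR d t w = get d t w
  | 0, nil, _ => rfl
  | 0, leaf _, _ => rfl
  | 0, node _ _, _ => rfl
  | _ + 1, nil, _ => rfl
  | _ + 1, leaf _, _ => rfl
  | d + 1, node l r, w => by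
    rw [getR_succ_node, show Nat.div w 2 = w / 2 from rfl, show Nat.mod w 2 = w % 2 from rfl, getR_eq d l,
      getR_eq d r, get]
    by_cases h : w % 2 = 0
    · rw [if_pos h, h]; rfl
    · rw [if_neg h, nat_beq_false h]; rfl

end Trie

/-- Term walk (raw `List.rec`): insert `c · wt` at key `w` for every term with `lo ≤ w < hi`. [folklore] -/
def accTermsR (d lo hi : ℕ) (wt : ℤ) (L : List (ℕ × ℤ)) : Trie → Trie :=
  @List.rec (ℕ × ℤ) (fun _ => Trie → Trie) (fun t => t)
    (fun p _ ih t => ih (bif Nat.ble lo p.1 && Nat.blt p.1 hi then Trie.addR d t p.1 (Int.mul p.2 wt) else t)) L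

/-- Unfolding `accTermsR` on a `cons`. [folklore] -/
theorem accTermsR_cons (d lo hi : ℕ) (wt : ℤ) (w : ℕ) (c : ℤ) (L : List (ℕ × ℤ)) (t : Trie) :
    accTermsR d lo hi wt ((w, c) :: L) t =
      accTermsR d lo hi wt L (bif Nat.ble lo w && Nat.blt w hi then Trie.addR d t w (Int.mul c wt) else t) := rfl

/-- `accTermsR = accTerms`. [folklore] -/
theorem accTermsR_eq (d lo hi : ℕ) (wt : ℤ) : ∀ (L : List (ℕ × ℤ)) (t : Trie),
    accTermsR d lo hi wt L t = accTerms d lo hi wt L t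
  | [], _ => rfl
  | (w, c) :: rest, t => by
    rw [accTermsR_cons, accTermsR_eq d lo hi wt rest, accTerms, Trie.addR_eq, show Int.mul c wt = c * wt from rfl]
    by_cases h : lo ≤ w ∧ w < hi
    · rw [if_pos h]
      have hb : (Nat.ble lo w && Nat.blt w hi) = true := by
        rw [Bool.and_eq_true, Nat.ble_eq, Nat.blt_eq]; exact h
      rw [hb]; rfl
    · rw [if_neg h]
      have hb : (Nat.ble lo w && Nat.blt w hi) = false := by
        rw [Bool.eq_false_iff]; intro h'; rw [Bool.and_eq_true, Nat.ble_eq, Nat.blt_eq] at h'; exact h h'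
      rw [hb]; rfl

/-- Row walk (raw `List.rec`) over the stored upper entries in lockstep with the factor rows; the weight is
`μ · ⟨G_i, G_{i+t}⟩`, `μ = 1` on the diagonal, `2` off it. [folklore] -/
def accRowR (d lo hi : ℕ) (Gi : List ℤ) (es : List (List (ℕ × ℤ))) : Bool → List (List ℤ) → Trie → Trie :=
  @List.rec (List (ℕ × ℤ)) (fun _ => Bool → List (List ℤ) → Trie → Trie) (fun _ _ t => t)
    (fun e _ ih first Gs t =>
      ih false Gs.tail (accTermsR d lo hi (Int.mul (bif first then 1 else 2) (listDot Gi (Gs.headD []))) e t)) es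

/-- Unfolding `accRowR` on a `cons`. [folklore] -/
theorem accRowR_cons (d lo hi : ℕ) (Gi : List ℤ) (e : List (ℕ × ℤ)) (es : List (List (ℕ × ℤ))) (first : Bool)
    (Gs : List (List ℤ)) (t : Trie) : accRowR d lo hi Gi (e :: es) first Gs t =
      accRowR d lo hi Gi es false Gs.tail
        (accTermsR d lo hi (Int.mul (bif first then 1 else 2) (listDot Gi (Gs.headD []))) e t) := rfl

/-- `accRowR` agrees with `accRowU` whenever the step counter covers the entry list. [folklore] -/
theorem accRowR_eq (d lo hi : ℕ) (Gi : List ℤ) : ∀ (es : List (List (ℕ × ℤ))) (n : ℕ) (first : Bool)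
    (Gs : List (List ℤ)) (t : Trie), es.length ≤ n →
    accRowR d lo hi Gi es first Gs t = accRowU d lo hi Gi n first es Gs t
  | [], n, _, _, _, _ => by cases n <;> rfl
  | _ :: _, 0, _, _, _, h => by simp at h
  | e :: es, n + 1, first, Gs, t, h => by
    rw [accRowR_cons, accRowR_eq d lo hi Gi es n false Gs.tail _ (by simpa using h), accRowU, accTermsR_eq]
    have hG : Gs.headD [] = Gs.getD 0 [] := by cases Gs <;> rfl
    rw [hG]
    cases first <;> rfl

/-- Row loop of block `k` (raw `Nat.rec`). [folklore] -/
def accIR (GB : List (List (List ℤ))) (EB : List (List (List (List (ℕ × ℤ))))) (d lo hi k : ℕ) (n : ℕ) :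
    Trie → Trie :=
  @Nat.rec (fun _ => Trie → Trie) (fun t => t)
    (fun i ih t => ih (accRowR d lo hi (grow GB k i) ((EB.getD k []).getD i []) true ((GB.getD k []).drop i) t)) n

/-- Unfolding `accIR`. [folklore] -/
theorem accIR_succ (GB : List (List (List ℤ))) (EB : List (List (List (List (ℕ × ℤ))))) (d lo hi k i : ℕ)
    (t : Trie) : accIR GB EB d lo hi k (i + 1) t =
      accIR GB EB d lo hi k i (accRowR d lo hi (grow GB k i) ((EB.getD k []).getD i []) true ((GB.getD k []).drop i) t) :=
  rfl

/-- Length check (family level, cheap): every stored entry row `EB[k][i]`, `i < m`, has at most `m − i` entries,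
so that the raw row walk (to the end of the list) agrees with the counted walk of part 4d. [folklore] -/
def rowLenCheck (EB : List (List (List (List (ℕ × ℤ))))) (m nb : ℕ) : Bool :=
  natAll nb fun k => natAll m fun i => decide (((EB.getD k []).getD i []).length ≤ m - i)

/-- `accIR = accIU` under the row-length hypothesis. [folklore] -/
theorem accIR_eq (GB : List (List (List ℤ))) (EB : List (List (List (List (ℕ × ℤ))))) (d lo hi m k : ℕ)
    (hk : ∀ i < m, ((EB.getD k []).getD i []).length ≤ m - i) :
    ∀ (n : ℕ) (t : Trie), n ≤ m → accIR GB EB d lo hi k n t = accIU GB EB d lo hi m k n t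
  | 0, _, _ => rfl
  | i + 1, t, hn => by
    rw [accIR_succ, accIR_eq GB EB d lo hi m k hk i _ (by omega), accIU,
      accRowR_eq _ _ _ _ _ _ _ _ _ (hk i (by omega))]

/-- Block loop (raw `Nat.rec`). [folklore] -/
def accKR (GB : List (List (List ℤ))) (EB : List (List (List (List (ℕ × ℤ))))) (d lo hi m : ℕ) (n : ℕ) :
    Trie → Trie :=
  @Nat.rec (fun _ => Trie → Trie) (fun t => t) (fun k ih t => ih (accIR GB EB d lo hi k m t)) n

/-- Unfolding `accKR`. [folklore] -/
theorem accKR_succ (GB : List (List (List ℤ))) (EB : List (List (List (List (ℕ × ℤ))))) (d lo hi m k : ℕ)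
    (t : Trie) : accKR GB EB d lo hi m (k + 1) t = accKR GB EB d lo hi m k (accIR GB EB d lo hi k m t) := rfl

/-- `accKR = accKU` under the row-length check. [folklore] -/
theorem accKR_eq (GB : List (List (List ℤ))) (EB : List (List (List (List (ℕ × ℤ))))) (d lo hi m : ℕ)
    {nb : ℕ} (h : rowLenCheck EB m nb = true) :
    ∀ (n : ℕ) (t : Trie), n ≤ nb → accKR GB EB d lo hi m n t = accKU GB EB d lo hi m n t
  | 0, _, _ => rfl
  | k + 1, t, hn => by
    have hk : ∀ i < m, ((EB.getD k []).getD i []).length ≤ m - i := fun i hi => by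
      have h1 := natAll_iff.mp h k (by omega)
      have h2 := natAll_iff.mp h1 i hi
      exact of_decide_eq_true h2
    rw [accKR_succ, accKR_eq GB EB d lo hi m h k _ (by omega), accKU, accIR_eq GB EB d lo hi m k hk m t le_rfl]

/-- **The raw-recursor lockstep sweep** (kernel-side twin of `sweepU`). [folklore] -/
def sweepR (GB : List (List (List ℤ))) (EB : List (List (List (List (ℕ × ℤ))))) (nb m d lo hi : ℕ) : Trie :=
  accKR GB EB d lo hi m nb Trie.nil

/-- `sweepR = sweepU` under the row-length check. [folklore] -/
theorem sweepR_eq {GB : List (List (List ℤ))} {EB : List (List (List (List (ℕ × ℤ))))} {nb m : ℕ}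
    (h : rowLenCheck EB m nb = true) (d lo hi : ℕ) : sweepR GB EB nb m d lo hi = sweepU GB EB nb m d lo hi :=
  accKR_eq GB EB d lo hi m h nb Trie.nil le_rfl

/-- Integer trace value of variable `v` (specification): `Σ_{k<nb} Σ_{i<m} Σ_{j<m} posTerm v (k, i, j)`
(`= 4^K · Σ_k tr (Z_k F⁽ᵏ⁾_v)`, cf. `sum_trace_zr_mul_fzE_eq_trZ`). [folklore] -/
def trZ (GB : List (List (List ℤ))) (EB : List (List (List (List (ℕ × ℤ))))) (nb m v : ℕ) : ℤ :=
  ∑ k ∈ Finset.range nb, ∑ i ∈ Finset.range m, ∑ j ∈ Finset.range m, posTerm GB EB v (k, i, j)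

/-- **Sweep semantics** (transferred from part 4d): for `lo ≤ v < hi ≤ 2^d` the accumulator of `v` is `trZ v`.
[folklore] -/
theorem getR_sweepR {GB : List (List (List ℤ))} {EB : List (List (List (List (ℕ × ℤ))))} {nb m d lo hi : ℕ}
    (h : rowLenCheck EB m nb = true) (hd : hi ≤ 2 ^ d) {v : ℕ} (hlo : lo ≤ v) (hhi : v < hi) :
    (sweepR GB EB nb m d lo hi).getR d v = trZ GB EB nb m v := by
  rw [Trie.getR_eq, sweepR_eq h, sweepU, get_accKU GB EB d lo hi hd m v (lt_of_lt_of_le hhi hd), winSum,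
    if_pos ⟨hlo, hhi⟩, trZ]
  simp [Trie.get]

end

end Summit.QuantumFields.GaugeBoot.Certificates.Sparse
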